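import Literature.AlgebraicGeometry.Motives.HodgeRiemannBilinearDischarge
import Literature.AlgebraicGeometry.HodgeTheory.KaehlerClass
import Literature.AlgebraicGeometry.HodgeTheory.HodgeTypeConjugation
import Literature.AlgebraicGeometry.HodgeTheory.HodgeFiltrationModelsReductionProofs
import Literature.AlgebraicGeometry.HodgeTheory.ComplexConjugationHolds
import Literature.NumberTheory.Transcendental.KaehlerHodgeEllipticRepresentativeProofs
import Literature.NumberTheory.Transcendental.DolbeaultProofs
import Literature.NumberTheory.Transcendental.DeRhamTheoremMultiplicative
import Literature.NumberTheory.Transcendental.FormIntegrationStokes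
import HarnessLib

/-!
# The Hodge–Riemann bilinear relation in degree one, on the summit carriers

Family `hodge`, layer `Literature/AlgebraicGeometry/HodgeTheory`. The tree proves the Hodge–Riemann
bilinear relations in their HARMONIC-FORM version on an abstract compact Kähler manifold
(`Motives.hodge_riemann_bilinear_holds`, file `Motives/HodgeRiemannBilinearDischarge`; Voisin I
Thm. 6.32, Huybrechts Prop. 3.3.15): for a non-zero `∂̄`-harmonic primitive `(p,q)`-form `α`,
`i^{p-q}(-1)^{k(k-1)/2} ∫ α ∧ ᾱ ∧ ω^r > 0`. This file carries the case `k = 1`, `(p, q) = (1, 0)`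
over to the summit carriers `Hᵏ(X(ℂ); ℂ) = complexBetti X k` of a smooth projective `X` — the three
comparisons named in the module docstring of `HodgeClassesCupPairing` (analytification `X^an → X(ℂ)`
of a Hodge model, de Rham ↔ singular cup product through the complexification `e ⊗ ℂ` of a
multiplicative real de Rham family, harmonic representatives):

* `MForm.eq_zero_of_lt` — forms of degree `> dim_ℝ` vanish (any coefficients);
* `hodgeRiemann_of_closed_oneZero` — **HR for closed `(1,0)`-forms**: on a compact connected Kähler
  manifold of complex dimension `1 + r`, for a non-zero closed smooth form `α` of type `(1, 0)`,
  `i ∫ α ∧ ᾱ ∧ ω^r` is real and `> 0`. A closed `(1,0)`-form is `∂̄`-closed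
  (`∂̄α = (dα)^{1,1} = 0`) hence `Δ_∂̄`-harmonic (`∂̄^*` kills `(p,0)`-forms,
  `isDolbeaultHarmonic_of_dolbeaultBar_eq_zero_of_type_zero`), and primitive because
  `α ∧ ω^{r+1}` has degree `2 dim_ℂ + 1`; so this IS Voisin's Thm. 6.32 at `k = 1`;
* `exists_closedForm_of_mem_hodgePQ` — an element of `H^{p,q} ⊆ Hᵏ_dR` (the span of the classes of
  closed `(p,q)`-forms) is the class of ONE closed `(p,q)`-form;
* `cintegralClass` — integration `H^n_dR(M; ℂ) →ₗ[ℂ] ℂ` on complex top de Rham cohomology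
  (`∫ Re + i ∫ Im`, Stokes: `deRhamCohomology.integral`), with `cintegralClass_mk : [γ] ↦ ∫ γ`;
* `HodgeModel.IsKaehlerClassVia.hodgeRiemann_one` — **the carrier statement.** For `X` smooth
  projective of dimension `m + 1` (`1 ≤ m`), a Hodge model `A`, a natural multiplicative real de
  Rham family `e` and a Kähler class `H` of `(A, e)`, there is a linear functional
  `τ : H^{1+(1+2m)}(X(ℂ); ℂ) → ℂ` such that for every NON-ZERO class `x ∈ H¹(X(ℂ); ℂ)` of Hodge type
  `(1, 0)` the number `i · τ(x ⌣ (x̄ ⌣ Hᵐ))` is real and `> 0` (`x̄ = conjClass x`, `Hᵐ = cupPowTwo H m`).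
  `τ = ∫ ∘ (e ⊗ ℂ)⁻¹ ∘ A^*`, and `A^*(x ⌣ x̄ ⌣ Hᵐ) = (e ⊗ ℂ)[α ∧ ᾱ ∧ ω^m]` for the closed
  `(1,0)`-form `α` representing `x` in the model `A` re-compared through `e ⊗ ℂ` (the device of
  `KaehlerClassHodgeType` / `CupPreservesHodgeTypeOfDeRham`; all models cut out the same `H^{1,0}`,
  `hodgePQ_independent_of_hodgeModel_holds`), by `complexifyFun_mk_wedge`,
  `cupPowTwo_ofRealClass_kaehlerClass` and `conjClass_complexifyFun`;
* `IsKaehlerClass.hodgeRiemann_one`, `IsKaehlerClass.hodgeRiemann_one_smul` — the same for the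
  model-free predicate `IsKaehlerClass`, and for every non-zero REAL multiple `t • H` of a Kähler
  class (the functional absorbs the sign of `tᵐ`), which is the form met by polarization classes
  `d·ι^*a + φ^*ι^*a` read against the hyperplane class.

This is the Hodge-theoretic input "`i ∫ h^{2n-1} ∧ α ∧ ᾱ > 0` on `H^{1,0}`" of van Geemen's
signature computation for abelian varieties of Weil type (LNM 1594, Lemma 5.2 (1); Birkenhake–Lange
Thm. 4.2.1), cf. `Summits/…/hyperbolic_eightfold_descent.stub_weilSignature`. No definition of a
carrier and no named fact is introduced (D-0026); the degree `1 + (1 + 2m)` is the cup product's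
natural target degree (no transport), and `1 ≤ m` only because `cupPowTwo H 0 = 1` is not compared
with `ω⁰` here. -- TODO(curves): the case `m = 0`.

## References

* [VoisinHodgeI2002] C. Voisin, Hodge Theory and Complex Algebraic Geometry I (CUP 2002), §5.1.4,
  §6.1.3 Cor. 6.12, Lemma 6.31, Thm. 6.32 (p. 128), §7.1.2.
* [Huybrechts2005] D. Huybrechts, Complex Geometry (Springer 2005), Cor. 1.2.36, Prop. 3.3.15.
* [vanGeemen1994HodgeAV] B. van Geemen, An introduction to the Hodge conjecture for abelian
  varieties, LNM 1594 (1994), Lemma 5.2 (1) and proof.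
* [LangeBirkenhake1992] H. Lange, Ch. Birkenhake, Complex Abelian Varieties (1992), Thm. 4.2.1.
* [WarnerGTM94] F. Warner, Foundations of Differentiable Manifolds and Lie Groups, 2.6, 4.9, 5.36, 5.45.
-/

noncomputable section

open scoped Manifold ContDiff
open CategoryTheory Bundle Module
open Literature.AlgebraicTopology.SingularHomology
open Literature.Geometry.Kaehler
open Literature.NumberTheory.Transcendental
open Literature.AlgebraicGeometry.Motives (cintegral re_cintegral im_cintegral kaehlerFormPow
  hodge_riemann_bilinear_holds exists_orientation_integral_kaehlerFormPow_pos)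

-- The identification `TangentSpace I x = E` is an abuse of definitional equality; as in the tree's
-- tangent-bundle files we let `isDefEq` unfold it.
set_option backward.isDefEq.respectTransparency false

namespace Literature.AlgebraicGeometry.HodgeTheory

section HodgeTheory

/-! ### Forms of degree beyond the real dimension vanish -/

section Vanishing

variable {E : Type*} [NormedAddCommGroup E] [NormedSpace ℝ E] [FiniteDimensional ℝ E] {n : ℕ}
  [Fact (finrank ℝ E = n)] {H' : Type*} [TopologicalSpace H'] {I : ModelWithCorners ℝ E H'}
  {M : Type*} [TopologicalSpace M] [ChartedSpace H' M]
  {A : Type*} [NormedAddCommGroup A] [NormedSpace ℝ A]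

/-- **Forms of degree `k > dim_ℝ M` vanish** (any normed coefficient space without real torsion):
`k` tangent vectors are linearly dependent and alternating maps kill dependent families
(Warner 2.6 (b) (2): `Λ_{d+j}(V) = 0`; the tree's `MForm.eq_zero_of_finrank_lt` is the real-valued
case with the degree spelled `n + j + 1`). [cite: WarnerGTM94, 2.6 (b) (2)] -/
theorem MForm.eq_zero_of_lt [NoZeroSMulDivisors ℝ A] {k : ℕ} (hk : n < k) (α : MForm I M A k) :
    α = 0 := by
  funext x
  ext v
  have hV : finrank ℝ (TangentSpace I x) = n := Fact.out
  have hli : ¬ LinearIndependent ℝ v := by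
    intro hli
    have := hli.fintype_card_le_finrank
    simp only [Fintype.card_fin, hV] at this
    omega
  simpa using (α x).toAlternatingMap.map_linearDependent v hli

end Vanishing

/-! ### Hodge–Riemann for closed `(1,0)`-forms -/

section Forms

variable {E : Type*} [NormedAddCommGroup E] [NormedSpace ℂ E] [FiniteDimensional ℂ E]
  {M : Type*} [TopologicalSpace M] [ChartedSpace E M] [IsManifold 𝓘(ℂ, E) ω M]
  [IsManifold 𝓘(ℝ, E) ∞ M] {n : ℕ} [Fact (finrank ℝ E = n)] [MeasurableSpace E] [BorelSpace E]
  [T2Space M] [CompactSpace M] [ConnectedSpace M]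
  (o : (x : M) → Orientation ℝ (TangentSpace 𝓘(ℝ, E) x) (Fin n))
  (g : ContMDiffRiemannianMetric 𝓘(ℝ, E) ∞ E (fun x : M ↦ TangentSpace 𝓘(ℝ, E) x))

/-- **The Hodge–Riemann bilinear relation for closed `(1,0)`-forms** (Voisin I Thm. 6.32 at
`k = 1`, `(p,q) = (1,0)`): on a compact connected Kähler manifold `(M, g)` of complex dimension
`1 + r`, with the orientation `o` normalised by `∫ ω^{1+r} > 0`, for a non-zero CLOSED smooth
complex `1`-form `α` of type `(1, 0)` the number `i ∫_M α ∧ ᾱ ∧ ω^r` is real and positive. A closed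
`(1,0)`-form has `∂̄α = (dα)^{1,1} = 0` (`IsOfType.dolbeaultBar_eq_holds`), so it is
`Δ_∂̄`-harmonic (`isDolbeaultHarmonic_of_dolbeaultBar_eq_zero_of_type_zero`: `∂̄^*` vanishes on
`(p,0)`-forms), and it is primitive, `α ∧ ω^{r+1} = 0`, by degree (`2(1+r) + 1 > dim_ℝ M`); hence the
tree's discharged hodge.S15 `hodge_riemann_bilinear_holds` applies, with
`i^{1-0}(-1)^{1·0/2} = i`. [cite: VoisinHodgeI2002, Thm. 6.32 and §5.1.4] [cite: Huybrechts2005, Prop. 3.3.15] -/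
theorem hodgeRiemann_of_closed_oneZero (hg : g.toRiemannianMetric.IsKaehler) {r : ℕ}
    (hr : 1 + r = finrank ℂ E) (h2d : 2 * finrank ℂ E = n) (h : 1 + (1 + 2 * r) = n)
    (hvol : letI : RiemannianBundle (fun x : M ↦ TangentSpace 𝓘(ℝ, E) x) := ⟨g.toRiemannianMetric⟩
      IsSmoothForm (riemannianVolumeForm o))
    (hpos : 0 < MForm.integral o ((kaehlerFormPow g.toRiemannianMetric (finrank ℂ E)).castDeg h2d))
    {α : MForm 𝓘(ℝ, E) M ℂ 1} (hαs : IsSmoothForm α) (hαc : mextDeriv α = 0) (hαt : IsOfType 1 0 α)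
    (hα0 : α ≠ 0) :
    0 < (Complex.I * cintegral o
        ((α.wedge (α.conj.wedge (kaehlerFormPow g.toRiemannianMetric r).ofReal)).castDeg h)).re ∧
      (Complex.I * cintegral o
        ((α.wedge (α.conj.wedge (kaehlerFormPow g.toRiemannianMetric r).ofReal)).castDeg h)).im = 0 := by
  letI : RiemannianBundle (fun x : M ↦ TangentSpace 𝓘(ℝ, E) x) := ⟨g.toRiemannianMetric⟩
  haveI : IsContMDiffRiemannianBundle 𝓘(ℝ, E) ∞ E (fun x : M ↦ TangentSpace 𝓘(ℝ, E) x) :=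
    ⟨g.inner, g.contMDiff, fun _ _ _ ↦ rfl⟩
  haveI : IsContinuousRiemannianBundle E (fun x : M ↦ TangentSpace 𝓘(ℝ, E) x) :=
    ⟨g.inner, g.contMDiff.continuous, fun _ _ _ ↦ rfl⟩
  haveI : Fact (IsSmoothForm (riemannianVolumeForm o)) := ⟨hvol⟩
  have hJ : ∀ (x : M) (v w : TangentSpace 𝓘(ℝ, E) x),
      inner ℝ (tangentJ E x v) (tangentJ E x w) = inner ℝ v w := fun x v w ↦ hg.isHermitian x v w
  -- `∂̄ α = (dα)^{1,1} = 0`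
  have hd : dolbeaultBar α = 0 := by
    rw [IsOfType.dolbeaultBar_eq_holds hαt, hαc, MForm.typeComponent_zero]
  -- a `∂̄`-closed `(1,0)`-form is `Δ_∂̄`-harmonic
  have hharm : IsDolbeaultHarmonic o 1 0 (show (1 + 0) + (1 + 2 * r) = n by omega) α :=
    isDolbeaultHarmonic_of_dolbeaultBar_eq_zero_of_type_zero o hJ _ hαs hαt hd
  have hmem : α ∈ dolbeaultHarmonicForms o 1 0 h := hharm.mem_dolbeaultHarmonicForms
  -- primitivity by degree
  have hprim : α.wedge (kaehlerFormPow g.toRiemannianMetric (r + 1)).ofReal = 0 :=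
    MForm.eq_zero_of_lt (n := n) (by omega) _
  have hHR := hodge_riemann_bilinear_holds o g hg (p := 1) (q := 0) (k := 1) (r := r) hr h2d h
    hvol hpos hmem hprim hα0
  have hC : Complex.I ^ (((1 : ℕ) : ℤ) - ((0 : ℕ) : ℤ)) * (-1 : ℂ) ^ (1 * (1 - 1) / 2) = Complex.I := by
    norm_num
  rw [hC] at hHR
  exact hHR

omit [ConnectedSpace M] in
/-- **Positive orientation in a prescribed top degree**: on a non-empty compact complex manifold
with a smooth Hermitian metric `g` there is a continuous (constant) orientation family `o` in the top
degree `n = 2 dim_ℂ` with `∫_M ω^{dim} > 0` (Voisin I §3.1.3 after Lemma 3.8; the tree's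
`exists_orientation_integral_kaehlerFormPow_pos`, transported along `2 dim_ℂ E = n`).
[cite: VoisinHodgeI2002, §3.1.3 Lemma 3.8] -/
theorem exists_orientation_integral_castDeg_kaehlerFormPow_pos [Nonempty M] (h2d : 2 * finrank ℂ E = n)
    (hg : g.toRiemannianMetric.IsHermitian) :
    ∃ o : (x : M) → Orientation ℝ (TangentSpace 𝓘(ℝ, E) x) (Fin n), IsContinuousOrientation o ∧
      0 < MForm.integral o ((kaehlerFormPow g.toRiemannianMetric (finrank ℂ E)).castDeg h2d) := by
  subst h2d
  obtain ⟨o₀, ho₀, hpos⟩ := exists_orientation_integral_kaehlerFormPow_pos (M := M) g hg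
  exact ⟨fun _ ↦ o₀, ho₀, by rwa [MForm.castDeg_rfl]⟩

end Forms

/-! ### Classes of `H^{p,q}` are classes of closed `(p,q)`-forms; integration on `Hⁿ_dR(M; ℂ)` -/

section DeRham

variable {E : Type*} [NormedAddCommGroup E] [NormedSpace ℂ E]
  {M : Type*} [TopologicalSpace M] [ChartedSpace E M] [IsManifold 𝓘(ℝ, E) ∞ M]

omit [IsManifold 𝓘(ℝ, E) ∞ M] in
/-- **An element of `H^{p,q}` is the class of a closed `(p,q)`-form** (`p + q = k`): `H^{p,q}` is
the `ℂ`-span of such classes, and closed `(p,q)`-forms form a subspace (`IsOfType.add/smul`).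
[cite: VoisinHodgeI2002, §6.1.3 and §7.1.1] -/
theorem exists_closedForm_of_mem_hodgePQ {k p q : ℕ}
    {w : complexDeRhamCohomology E M k} (hw : w ∈ hodgePQ E M k p q) (hpq : p + q = k) :
    ∃ β : cclosedSmoothForms E M k, IsOfType p q (β : MForm 𝓘(ℝ, E) M ℂ k) ∧
      complexDeRhamCohomology.mk E M k β = w := by
  induction hw using Submodule.span_induction with
  | mem u hu =>
    obtain ⟨β, hβ, rfl⟩ := hu
    exact ⟨β, hβ, rfl⟩
  | zero => exact ⟨0, isOfType_zero hpq, map_zero _⟩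
  | add u v _ _ hu hv =>
    obtain ⟨β, hβ, rfl⟩ := hu
    obtain ⟨γ, hγ, rfl⟩ := hv
    exact ⟨β + γ, hβ.add hγ, map_add _ _ _⟩
  | smul c u _ hu =>
    obtain ⟨β, hβ, rfl⟩ := hu
    exact ⟨c • β, hβ.smul c, map_smul _ _ _⟩

variable [FiniteDimensional ℂ E] {n : ℕ} [Fact (finrank ℝ E = n)] [MeasurableSpace E] [BorelSpace E]
  [T2Space M] [CompactSpace M]
  (o : (x : M) → Orientation ℝ (TangentSpace 𝓘(ℝ, E) x) (Fin n)) (ho : IsContinuousOrientation o)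

/-- **Integration on complex top de Rham cohomology**, `Hⁿ_dR(M; ℂ) →ₗ[ℂ] ℂ`,
`c ↦ ∫ re c + i ∫ im c` (the real integral on `Hⁿ_dR(M; ℝ)`, `deRhamCohomology.integral`, well
defined by Stokes `∫ dβ = 0`, the tree's `MForm.integral_eq_zero_of_mem_exactSmoothForms_holds`).
[cite: WarnerGTM94, 4.9 and 5.36] [cite: VoisinHodgeI2002, §6.3.2] -/
def cintegralClass : complexDeRhamCohomology E M n →ₗ[ℂ] ℂ where
  toFun c := ((deRhamCohomology.integral o ho (MForm.integral_add_holds o)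
      (MForm.integral_eq_zero_of_mem_exactSmoothForms_holds o) (complexDeRhamCohomology.re E M n c) : ℝ) : ℂ) +
    Complex.I * ((deRhamCohomology.integral o ho (MForm.integral_add_holds o)
      (MForm.integral_eq_zero_of_mem_exactSmoothForms_holds o) (complexDeRhamCohomology.im E M n c) : ℝ) : ℂ)
  map_add' c c' := by
    simp only [map_add, Complex.ofReal_add]
    ring
  map_smul' z c := by
    simp only [complexDeRhamCohomology.re_smul, complexDeRhamCohomology.im_smul, map_sub, map_add,
      map_smul, smul_eq_mul, Complex.ofReal_sub, Complex.ofReal_add, Complex.ofReal_mul,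
      RingHom.id_apply]
    apply Complex.ext
    · simp only [Complex.add_re, Complex.mul_re, Complex.ofReal_re, Complex.ofReal_im, Complex.I_re,
        Complex.I_im, Complex.sub_re, Complex.mul_im, Complex.add_im]
      ring
    · simp only [Complex.add_im, Complex.mul_im, Complex.ofReal_re, Complex.ofReal_im, Complex.I_re,
        Complex.I_im, Complex.sub_im, Complex.mul_re, Complex.add_re]
      ring

/-- `cintegralClass [γ] = ∫_M γ` for a closed smooth complex top form `γ`. [cite: WarnerGTM94, 4.9] -/
theorem cintegralClass_mk (γ : cclosedSmoothForms E M n) :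
    cintegralClass o ho (complexDeRhamCohomology.mk E M n γ) = cintegral o (γ : MForm 𝓘(ℝ, E) M ℂ n) := by
  change ((deRhamCohomology.integral o ho (MForm.integral_add_holds o)
      (MForm.integral_eq_zero_of_mem_exactSmoothForms_holds o) (complexDeRhamCohomology.re E M n _) : ℝ) : ℂ) +
    Complex.I * ((deRhamCohomology.integral o ho (MForm.integral_add_holds o)
      (MForm.integral_eq_zero_of_mem_exactSmoothForms_holds o) (complexDeRhamCohomology.im E M n _) : ℝ) : ℂ) = _
  rw [complexDeRhamCohomology.re_mk, complexDeRhamCohomology.im_mk, deRhamCohomology.integral_mk,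
    deRhamCohomology.integral_mk]
  rfl

end DeRham

/-! ### The carrier statement -/

section Carrier

universe u

variable {m n : ℕ} {X : Motives.SchemeOver ℂ}

/-- **A class of Hodge type `(1, 0)` is represented, in a Hodge model re-compared through `e ⊗ ℂ`,
by a closed `(1,0)`-form**: `A^* x = (e ⊗ ℂ)[α]` (all Hodge models cut out the same `H^{1,0}`,
`hodgePQ_independent_of_hodgeModel_holds`; the device of `KaehlerClassHodgeType`).
[cite: VoisinHodgeI2002, §6.1.3 and §7.1.1] -/
theorem HodgeModel.exists_closedForm_oneZero_of_isOfHodgeType (A : HodgeModel n X)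
    {e : DeRhamIsoFamily 𝓘(ℝ, A.model)} (he : e.IsNatural) (hX : Motives.IsSmoothProjective n X)
    {x : complexBetti X 1} (hx : IsOfHodgeType n X 1 1 0 x) :
    ∃ α : cclosedSmoothForms A.model A.carrier 1, IsOfType 1 0 (α : MForm 𝓘(ℝ, A.model) A.carrier ℂ 1) ∧
      A.pullback 1 x = complexifyFun e 1 (complexDeRhamCohomology.mk A.model A.carrier 1 α) := by
  let A' : HodgeModel n X :=
    { A with
      deRham := e.complexify
      deRham_isNatural := DeRhamIsoFamily.complexify_isNatural he }
  have hxA : A'.pullback 1 x ∈ A'.hodgePQ 1 1 0 := hx.mem_hodgePQ hX A'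
  obtain ⟨w, hw, hwx⟩ := Submodule.mem_map.1 hxA
  obtain ⟨α, hαt, rfl⟩ := exists_closedForm_of_mem_hodgePQ hw rfl
  exact ⟨α, hαt, hwx.symm⟩

/-- **`A^*(x ⌣ x̄ ⌣ Hᵐ) = (e ⊗ ℂ)[α ∧ ᾱ ∧ ω^m]`** for `A^* x = (e ⊗ ℂ)[α]`, `A^* H = e[ω_g] ⊗ 1`,
`e` multiplicative and `1 ≤ m`: `A^*` is multiplicative and commutes with conjugation
(`cupProduct_map`, `map_cupPowTwo`, `conjClass_map`), `e ⊗ ℂ` is multiplicative on classes of closed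
forms (`complexifyFun_mk_wedge`) and real (`conjClass_complexifyFun`), and `(e[ω] ⊗ 1)ᵐ = e[ωᵐ] ⊗ 1`
(`cupPowTwo_ofRealClass_kaehlerClass`). [cite: VoisinHodgeI2002, §6.1.3 Cor. 6.12 and Thm. 5.29] [cite: WarnerGTM94, Thm. 5.45] -/
theorem HodgeModel.pullback_cupProduct_conjClass_cupPowTwo (A : HodgeModel n X)
    {e : DeRhamIsoFamily 𝓘(ℝ, A.model)} (hem : e.IsMultiplicative) (hm : 1 ≤ m)
    [WedgeFacts 𝓘(ℝ, A.model) A.carrier ℝ] [WedgeFacts 𝓘(ℝ, A.model) A.carrier ℂ]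
    (hω : isSmoothForm_kaehlerForm_of_isManifold_complex (E := A.model) (M := A.carrier))
    (g : ContMDiffRiemannianMetric 𝓘(ℝ, A.model) ∞ A.model (fun x : A.carrier ↦ TangentSpace 𝓘(ℝ, A.model) x))
    (hg : g.toRiemannianMetric.IsKaehler) {H : complexBetti X 2}
    (hHg : A.pullback 2 H = ofRealClass A.carrier 2 (e A.carrier 2 (g.kaehlerClass hω hg)))
    {x : complexBetti X 1} (α : cclosedSmoothForms A.model A.carrier 1)
    (hxα : A.pullback 1 x = complexifyFun e 1 (complexDeRhamCohomology.mk A.model A.carrier 1 α)) :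
    A.pullback (1 + (1 + 2 * m)) (cupProduct rfl x
      (cupProduct rfl (conjClass (Motives.ComplexPoints X) 1 x) (cupPowTwo H m))) =
      complexifyFun e (1 + (1 + 2 * m)) (complexDeRhamCohomology.mk A.model A.carrier _
        ⟨(α : MForm 𝓘(ℝ, A.model) A.carrier ℂ 1).wedge
          ((α : MForm 𝓘(ℝ, A.model) A.carrier ℂ 1).conj.wedge (kaehlerFormPow g.toRiemannianMetric m).ofReal),
          wedge_mem_cclosedSmoothForms α.2 (wedge_mem_cclosedSmoothForms (conj_mem_cclosedSmoothForms_holds α.2)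
            (ofReal_mem_cclosedSmoothForms (A.kaehlerFormPow_mem_closedSmoothForms g hg m)))⟩) := by
  -- the two other factors as `(e ⊗ ℂ)`-images of closed forms
  have hconj : A.pullback 1 (conjClass (Motives.ComplexPoints X) 1 x) =
      complexifyFun e 1 (complexDeRhamCohomology.mk A.model A.carrier 1
        ⟨(α : MForm 𝓘(ℝ, A.model) A.carrier ℂ 1).conj, conj_mem_cclosedSmoothForms_holds α.2⟩) := by
    have h1 : A.pullback 1 (conjClass (Motives.ComplexPoints X) 1 x) =
        conjClass A.carrier 1 (A.pullback 1 x) := (conjClass_map _ x).symm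
    rw [h1, hxα, conjClass_complexifyFun, complexDeRhamCohomology.conj_mk]
  have hpow : A.pullback (2 * m) (cupPowTwo H m) =
      complexifyFun e (2 * m) (complexDeRhamCohomology.mk A.model A.carrier (2 * m)
        ⟨(kaehlerFormPow g.toRiemannianMetric m).ofReal,
          ofReal_mem_cclosedSmoothForms (A.kaehlerFormPow_mem_closedSmoothForms g hg m)⟩) := by
    have h1 : A.pullback (2 * m) (cupPowTwo H m) = cupPowTwo (A.pullback 2 H) m := map_cupPowTwo _ H m
    rw [h1, hHg, A.cupPowTwo_ofRealClass_kaehlerClass e hem hω g hg hm]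
    exact (complexifyFun_ofReal e (2 * m) _).symm
  -- multiplicativity
  have h2 : A.pullback (1 + (1 + 2 * m)) (cupProduct rfl x
      (cupProduct rfl (conjClass (Motives.ComplexPoints X) 1 x) (cupPowTwo H m))) =
      cupProduct rfl (A.pullback 1 x) (cupProduct rfl (A.pullback 1 (conjClass (Motives.ComplexPoints X) 1 x))
        (A.pullback (2 * m) (cupPowTwo H m))) := by
    change singularCohomology.map ℂ ℂ _ _ _ = _
    rw [cupProduct_map, cupProduct_map]
  rw [h2, hconj, hpow, hxα, ← complexifyFun_mk_wedge hem, ← complexifyFun_mk_wedge hem]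

/-- `1 + (1 + 2m) = 2(m+1)`: the canonical top degree. [folklore] -/
theorem one_add_one_add_two_mul (m : ℕ) : 1 + (1 + 2 * m) = 2 * (m + 1) := by ring

/-- **The Hodge–Riemann bilinear relation in degree one, on `H*(X(ℂ); ℂ)`.** Let `X` be smooth
projective of dimension `m + 1`, `1 ≤ m`, `A` a Hodge model of `X`, `e` a natural and
multiplicative real de Rham comparison family over the `A.model`-manifolds (de Rham's theorem,
`exists_deRhamIsoFamily_holds`) and `H ∈ H²(X(ℂ); ℂ)` a Kähler class of `(A, e)`
(`A^* H = e[ω_g] ⊗ 1`, `g` a Kähler metric on `X^an`). Then there is a `ℂ`-linear functional `τ` on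
`H^{1+(1+2m)}(X(ℂ); ℂ)` — namely `∫_{X^an} ∘ (e ⊗ ℂ)⁻¹ ∘ A^*` for the complex orientation — such
that for every non-zero class `x` of Hodge type `(1, 0)`,
`i · τ (x ⌣ (x̄ ⌣ Hᵐ))` is REAL and POSITIVE (`x̄ = conjClass x`, `Hᵐ = cupPowTwo H m`): writing
`A^* x = (e ⊗ ℂ)[α]` with `α` a closed `(1,0)`-form
(`HodgeModel.exists_closedForm_oneZero_of_isOfHodgeType`),
`A^*(x ⌣ x̄ ⌣ Hᵐ) = (e ⊗ ℂ)[α ∧ ᾱ ∧ ω^m]` (`HodgeModel.pullback_cupProduct_conjClass_cupPowTwo`), so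
the number is `i ∫ α ∧ ᾱ ∧ ω^m > 0` (`hodgeRiemann_of_closed_oneZero`). Voisin I Thm. 6.32
(`k = 1`: "the form `i H₁(α, ᾱ)` is positive definite on `H^{1,0}`"), Lemma 6.31; this is the input
of van Geemen's Lemma 5.2 (1).
[cite: VoisinHodgeI2002, Thm. 6.32 and §7.1.2] [cite: vanGeemen1994HodgeAV, Lemma 5.2 (1) and proof] -/
theorem HodgeModel.IsKaehlerClassVia.hodgeRiemann_one (hm : 1 ≤ m) (A : HodgeModel (m + 1) X)
    {e : DeRhamIsoFamily 𝓘(ℝ, A.model)} (he : e.IsNatural) (hem : e.IsMultiplicative)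
    (hX : Motives.IsSmoothProjective (m + 1) X) {H : complexBetti X 2} (hH : A.IsKaehlerClassVia e H) :
    ∃ τ : complexBetti X (1 + (1 + 2 * m)) →ₗ[ℂ] ℂ, ∀ x : complexBetti X 1,
      IsOfHodgeType (m + 1) X 1 1 0 x → x ≠ 0 →
        0 < (Complex.I * τ (cupProduct rfl x (cupProduct rfl (conjClass (Motives.ComplexPoints X) 1 x)
          (cupPowTwo H m)))).re ∧
        (Complex.I * τ (cupProduct rfl x (cupProduct rfl (conjClass (Motives.ComplexPoints X) 1 x)
          (cupPowTwo H m)))).im = 0 := by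
  obtain ⟨g, hg, hHg⟩ := hH
  -- instances on the carrier
  borelize A.model
  haveI : Nonempty A.carrier := A.nonempty_carrier hX
  haveI : CompactSpace A.carrier := by
    haveI := Motives.ComplexPoints.compactSpace_of_isSmoothProjective hX
    exact A.isAnalytification.homeomorph.symm.compactSpace
  haveI : ConnectedSpace A.carrier := A.connectedSpace_carrier hX
  have hdim : finrank ℂ A.model = m + 1 := A.isAnalytification.finrank_eq
  haveI hF : Fact (finrank ℝ A.model = 1 + (1 + 2 * m)) :=
    ⟨by rw [finrank_real_of_complex, hdim]; ring⟩
  haveI : WedgeFacts 𝓘(ℝ, A.model) A.carrier ℝ :=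
    wedgeFacts_of_assoc 𝓘(ℝ, A.model) A.carrier ℝ (ContinuousAlternatingMap.WedgeAssoc_holds ℝ A.model ℝ)
  haveI : WedgeFacts 𝓘(ℝ, A.model) A.carrier ℂ :=
    wedgeFacts_of_assoc 𝓘(ℝ, A.model) A.carrier ℂ (ContinuousAlternatingMap.WedgeAssoc_holds ℝ A.model ℂ)
  have h2d : 2 * finrank ℂ A.model = 1 + (1 + 2 * m) := by rw [hdim]; ring
  have hr : 1 + m = finrank ℂ A.model := by rw [hdim, add_comm]
  have hω := isSmoothForm_kaehlerForm_of_isManifold_complex_holds (E := A.model) (M := A.carrier)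
  -- the complex orientation and its normalisation
  obtain ⟨o, ho, hpos⟩ := exists_orientation_integral_castDeg_kaehlerFormPow_pos
    (M := A.carrier) g h2d hg.isHermitian
  have hvol : letI : RiemannianBundle (fun x : A.carrier ↦ TangentSpace 𝓘(ℝ, A.model) x) :=
      ⟨g.toRiemannianMetric⟩
      IsSmoothForm (riemannianVolumeForm o) := by
    letI : RiemannianBundle (fun x : A.carrier ↦ TangentSpace 𝓘(ℝ, A.model) x) := ⟨g.toRiemannianMetric⟩
    haveI : IsContMDiffRiemannianBundle 𝓘(ℝ, A.model) ∞ A.model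
        (fun x : A.carrier ↦ TangentSpace 𝓘(ℝ, A.model) x) := ⟨g.inner, g.contMDiff, fun _ _ _ ↦ rfl⟩
    haveI : IsContinuousRiemannianBundle A.model (fun x : A.carrier ↦ TangentSpace 𝓘(ℝ, A.model) x) :=
      ⟨g.inner, g.contMDiff.continuous, fun _ _ _ ↦ rfl⟩
    exact isSmoothForm_riemannianVolumeForm_of_isContinuousOrientation_holds o ho
  -- the functional `τ = ∫ ∘ (e ⊗ ℂ)⁻¹ ∘ A^*`
  refine ⟨(cintegralClass o ho).comp ((e.complexifyEquiv A.carrier (1 + (1 + 2 * m))).symm.toLinearMap.comp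
      (A.pullback (1 + (1 + 2 * m))).hom), fun x hx hx0 ↦ ?_⟩
  -- a closed `(1,0)`-form representing `x`
  obtain ⟨α, hαt, hxα⟩ := A.exists_closedForm_oneZero_of_isOfHodgeType he hX hx
  have hαs : IsSmoothForm (α : MForm 𝓘(ℝ, A.model) A.carrier ℂ 1) := ((mem_cclosedSmoothForms_iff _).1 α.2).1
  have hαc : mextDeriv (α : MForm 𝓘(ℝ, A.model) A.carrier ℂ 1) = 0 := ((mem_cclosedSmoothForms_iff _).1 α.2).2
  have hα0 : (α : MForm 𝓘(ℝ, A.model) A.carrier ℂ 1) ≠ 0 := by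
    intro h0
    apply hx0
    apply A.pullback_injective 1
    have hz : α = 0 := Subtype.ext h0
    rw [hxα, hz, map_zero, map_zero]
    exact (e.complexifyEquiv A.carrier 1).map_zero
  -- evaluate `τ`
  rw [LinearMap.comp_apply, LinearMap.comp_apply, LinearEquiv.coe_coe,
    show (A.pullback (1 + (1 + 2 * m))).hom (cupProduct rfl x (cupProduct rfl
      (conjClass (Motives.ComplexPoints X) 1 x) (cupPowTwo H m))) = A.pullback (1 + (1 + 2 * m))
        (cupProduct rfl x (cupProduct rfl (conjClass (Motives.ComplexPoints X) 1 x) (cupPowTwo H m))) from rfl,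
    A.pullback_cupProduct_conjClass_cupPowTwo hem hm hω g hg hHg α hxα,
    ← complexifyEquiv_apply, LinearEquiv.symm_apply_apply, cintegralClass_mk]
  have key := hodgeRiemann_of_closed_oneZero o g hg hr h2d rfl hvol hpos hαs hαc hαt hα0
  rw [MForm.castDeg_rfl] at key
  exact key

/-- **Hodge–Riemann in degree one for a Kähler class** (`IsKaehlerClass`, the model-free predicate:
Kähler for some Hodge model and some natural multiplicative real de Rham family).
[cite: VoisinHodgeI2002, Thm. 6.32 and §7.1.2] -/
theorem IsKaehlerClass.hodgeRiemann_one (hm : 1 ≤ m) (hX : Motives.IsSmoothProjective (m + 1) X)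
    {H : complexBetti X 2} (hH : IsKaehlerClass (m + 1) X H) :
    ∃ τ : complexBetti X (1 + (1 + 2 * m)) →ₗ[ℂ] ℂ, ∀ x : complexBetti X 1,
      IsOfHodgeType (m + 1) X 1 1 0 x → x ≠ 0 →
        0 < (Complex.I * τ (cupProduct rfl x (cupProduct rfl (conjClass (Motives.ComplexPoints X) 1 x)
          (cupPowTwo H m)))).re ∧
        (Complex.I * τ (cupProduct rfl x (cupProduct rfl (conjClass (Motives.ComplexPoints X) 1 x)
          (cupPowTwo H m)))).im = 0 := by
  obtain ⟨A, e, he, hem, hH⟩ := (isKaehlerClass_iff H).1 hH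
  exact hH.hodgeRiemann_one hm A he hem hX

/-- `(t • H)ᵐ = tᵐ • Hᵐ` for the cup powers of a degree-`2` class. [cite: HatcherAT2002, §3.2] -/
theorem cupPowTwo_smul {Y : Type} [TopologicalSpace Y] (t : ℂ) (x : singularCohomology ℂ ℂ Y 2) (i : ℕ) :
    cupPowTwo (t • x) i = t ^ i • cupPowTwo x i := by
  induction i with
  | zero => rw [cupPowTwo_zero, cupPowTwo_zero, pow_zero, one_smul]
  | succ i ih =>
    rw [cupPowTwo_succ, cupPowTwo_succ, ih]
    simp only [map_smul, LinearMap.smul_apply, smul_smul, pow_succ, mul_comm]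

/-- **Hodge–Riemann in degree one for a non-zero real multiple of a Kähler class**: for
`h = t • H`, `H` Kähler, `t ∈ ℝ ∖ {0}`, there is a functional `τ` with `i · τ(x ⌣ x̄ ⌣ hᵐ)` real
and positive on the non-zero `(1,0)`-classes (`hᵐ = tᵐ Hᵐ`; take `t⁻ᵐ · τ_H`). This is the form in
which polarization-type classes `d · ι^*a + φ^* ι^*a` (real multiples of the hyperplane class) are
met. [cite: VoisinHodgeI2002, Thm. 6.32 and §7.1.2] [cite: vanGeemen1994HodgeAV, Lemma 5.2 (1)] -/
theorem IsKaehlerClass.hodgeRiemann_one_smul (hm : 1 ≤ m) (hX : Motives.IsSmoothProjective (m + 1) X)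
    {H : complexBetti X 2} (hH : IsKaehlerClass (m + 1) X H) {t : ℝ} (ht : t ≠ 0) :
    ∃ τ : complexBetti X (1 + (1 + 2 * m)) →ₗ[ℂ] ℂ, ∀ x : complexBetti X 1,
      IsOfHodgeType (m + 1) X 1 1 0 x → x ≠ 0 →
        0 < (Complex.I * τ (cupProduct rfl x (cupProduct rfl (conjClass (Motives.ComplexPoints X) 1 x)
          (cupPowTwo ((t : ℂ) • H) m)))).re ∧
        (Complex.I * τ (cupProduct rfl x (cupProduct rfl (conjClass (Motives.ComplexPoints X) 1 x)
          (cupPowTwo ((t : ℂ) • H) m)))).im = 0 := by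
  obtain ⟨τ, hτ⟩ := hH.hodgeRiemann_one hm hX
  refine ⟨((t : ℂ) ^ m)⁻¹ • τ, fun x hx hx0 ↦ ?_⟩
  have htm : ((t : ℂ) ^ m) ≠ 0 := pow_ne_zero _ (Complex.ofReal_ne_zero.2 ht)
  have hc : cupProduct rfl x (cupProduct rfl (conjClass (Motives.ComplexPoints X) 1 x) (cupPowTwo ((t : ℂ) • H) m)) =
      ((t : ℂ) ^ m) • cupProduct (rfl : 1 + (1 + 2 * m) = 1 + (1 + 2 * m)) x
        (cupProduct (rfl : 1 + 2 * m = 1 + 2 * m) (conjClass (Motives.ComplexPoints X) 1 x) (cupPowTwo H m)) := by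
    rw [cupPowTwo_smul, LinearMap.map_smul, LinearMap.map_smul]
  have hτ' : (((t : ℂ) ^ m)⁻¹ • τ) (cupProduct rfl x (cupProduct rfl (conjClass (Motives.ComplexPoints X) 1 x)
      (cupPowTwo ((t : ℂ) • H) m))) =
      τ (cupProduct rfl x (cupProduct rfl (conjClass (Motives.ComplexPoints X) 1 x) (cupPowTwo H m))) := by
    rw [hc, LinearMap.smul_apply, LinearMap.map_smul, smul_eq_mul, smul_eq_mul, ← mul_assoc,
      inv_mul_cancel₀ htm, one_mul]
  rw [hτ']
  exact hτ x hx hx0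

end Carrier

end HodgeTheory

end Literature.AlgebraicGeometry.HodgeTheory

end
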